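import Summits.BirchSwinnertonDyer.Rank1Residual.AdditivePotMult.ModelFreeClassTheorems
import HarnessLib

/-!
# Route `GenusKolyvaginAtTwo`, crux U₂ `MinimalTwinBSDTwo` (stmt-BirchSwinnertonDyer-22985), LINE 23 «twin_swap»:
# THE TWIN-SWAP ASCENT (part 1, model-free, any prime `p`) — `BSD(W,p)` CLIMBS to the quadratic twin through the `p`-part over `K`

Seat `bsd-line-gk2-p2` g24 (PROVER 2/3, cell `bsd-f1-sign2`; LINE 23 holder after g23), `--supports stmt-BirchSwinnertonDyer-22985` (helper;
closes nothing).  THEOREMS ONLY (no definition, no named fact, no `sorry`); standard axioms.  **BSD is NOT proved by this file; U₂ / hTw is NOT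
proved; no item is closed.**  Everything here is bookkeeping at ANY prime `p`, CONDITIONAL only on its displayed binders (modularity `hmod`,
Gross–Zagier–Kolyvagin `hGZK`, and in §2 Milne 1972 any-model `hMilneC` — the route's PRINT items 19273 / 19921 / 24149).

WHY.  For a quadratic-twist pair `(W, Wd ≅ W^(d_K))` of analytic ranks `≤ 1` the tree has TWO edges of a triangle: DESCENT
`MissingPPartOverCAt V p ∧ BSD(Wd,p) ⟹ BSD(W,p)` (`AdditivePotMult.bsdp_of_pPartOverC_of_bsdp_twist` / `…_baseChange`; used by the route's
`ExactDescentAtTwo` p588019 and by LINE 23's S3 p764815 / p766443 / p766822 / p767397) and EXACTNESS `BSD(W,p) ∧ BSD(Wd,p) ⟹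
MissingPPartOverCAt V p` (`missingPPartOverCAt_iff_bsdp`; the losslessness files p765721, p763825).  This file supplies the THIRD edge, the
ASCENT `MissingPPartOverCAt V p ∧ BSD(W,p) ⟹ BSD(Wd,p)`, by the same algebra — Milne's model-free Weil-restriction identity (★)
`#Ш_an(V)·#Ш(W)·#Ш(Wd) = #Ш_an(W)·#Ш_an(Wd)·#Ш(V)` (`shaAnOverC_mul_eq`) solved for the TWIN and read `p`-adically:

* §1 (any `K`-model `V` of `W_K`, Weil-restriction identity `hWR` displayed) `exists_shaAn_twist_eq_of_overC`,
  **`bsdp_twist_of_pPartOverC_of_bsdp`**, `bsdp_iff_bsdp_twist_of_pPartOverC`;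
* §2 (canonical model `W.baseChange K`, `hWR` and `Ш(E_K)` finite from Milne 1972) **`bsdp_twist_of_pPartOverC_baseChange_of_bsdp`**,
  **`bsdp_iff_bsdp_twist_of_pPartOverC_baseChange`**, `pPartOverC_baseChange_of_bsdp_of_bsdp_twist` — so ANY TWO of `BSD(W,p)`, `BSD(Wd,p)`,
  `MissingPPartOverCAt (W ⊗ K) p` give the third.

Part 2 (`…SwappedPairAscentCells.lean`) reads the triangle on the route's frames at `p = 2` (habitat frame, swapped frame, and the live cells of
`closes` rev 57 by item name): there `BSD₂(E) ↔ BSD₂(Wd)` modulo the cell's exactness kernel and PRINT — `closes` and LINE 23 are invertible.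
BSD is NOT proved by any of this.

References: [Milne1972ArithmeticAV] §1 Thm. 1; [DokchitserDokchitserAnnals2010] §2.1; [Miller2011LMS] Def. 1.1 and §§4–5 (the same
swapped-pair bookkeeping curve by curve for `N < 5000`); [GrossZagier1986] V.§2 (2.2).
-/

set_option autoImplicit false
set_option linter.dupNamespace false -- `Summit.<P>.<Sub>` repeats `BirchSwinnertonDyer` (D-0017)

noncomputable section

open scoped Classical

open WeierstrassCurve Literature.NumberTheory.EllipticCurves
  Literature.NumberTheory.EllipticCurves.ModularForms
  Literature.NumberTheory.EllipticCurves.Rank1Residual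
  Literature.NumberTheory.EllipticCurves.Rank1Residual.Typed
  Summit.BirchSwinnertonDyer.Rank1Residual.AdditivePotMult

namespace Summit.BirchSwinnertonDyer.BirchSwinnertonDyer.Theorems.GenusExact.TwinSwap.Ascent

/-! ## §1 ASCENT, model-free, any prime `p`: the third edge of the triangle `{BSD(W,p), BSD(Wd,p), MissingPPartOverCAt V p}` -/

section ModelFree

variable (W : WeierstrassCurve ℚ) [W.IsElliptic] (p : ℕ) [Fact p.Prime]
  (K : Type) [Field K] [NumberField K]
  (Wd : WeierstrassCurve ℚ) [Wd.IsElliptic] (V : WeierstrassCurve K) [V.IsElliptic]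

omit [Fact p.Prime] in
/-- Rationality transfers SIDEWAYS on `V`: `#Ш_an(Wd) = q'·#Ш(W)·#Ш(Wd)/(q·#Ш(V))` for rational values `#Ш_an(V) = q'`, `#Ш_an(W) = q`
(the identity (★) `shaAnOverC_mul_eq` solved for the TWIN; mirror of `exists_shaAn_eq_of_overC`). [folklore] -/
theorem exists_shaAn_twist_eq_of_overC (hmod : hasEntireLFunction_rat) (h2 : Module.finrank ℚ K = 2)
    (hWd : ∃ C : VariableChange ℚ, C • W.quadraticTwist (NumberField.discr K : ℚ) = Wd)
    (hV : ∃ C : VariableChange K, C • W.baseChange K = V)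
    (hshaW : W.ShaFinite) (hshaD : Wd.ShaFinite) (hshaK : V.ShaFinite)
    (hWR : (V.shaOrder : ℝ) * V.regulator * V.bsdPeriod * (V.modifiedTamagawaProduct : ℝ) /
        (V.torsionOrder : ℝ) ^ 2 = W.bsdRHS * Wd.bsdRHS)
    {q' q : ℚ} (hq' : shaAnOverC V = (q' : ℂ)) (hq : shaAn W = (q : ℂ)) :
    shaAn Wd = ((q' * W.shaOrder * Wd.shaOrder / (q * V.shaOrder) : ℚ) : ℂ) := by
  have hstar := shaAnOverC_mul_eq W K Wd V hmod h2 hWd hV hshaW hshaD hWR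
  have hsK : V.shaOrder ≠ 0 := (V.shaOrder_pos hshaK).ne'
  have hq0 : (q : ℂ) ≠ 0 := by rw [← hq]; exact shaAn_ne_zero W hmod
  have hden : (q : ℂ) * (V.shaOrder : ℂ) ≠ 0 := mul_ne_zero hq0 (by exact_mod_cast hsK)
  push_cast
  rw [eq_div_iff hden, ← hq, ← hq']
  linear_combination -hstar

/-- **ASCENT THEOREM, model-free (any prime `p`).** `W/ℚ` of analytic rank `≤ 1` WITH `BSD(W,p)`, `K` quadratic, `Wd` a model of
`W^{(d_K)}` of analytic rank `≤ 1`, `V` ANY `K`-model of `W_K` with `Ш(V)` finite and the model-free Weil-restriction identity `hWR`: then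
**`MissingPPartOverCAt V p → BSDp Wd p`** — the `p`-part of BSD climbs from `W` to its twin through the `p`-part over `K`.  The third edge of the
triangle whose other two edges are the tree's DESCENT `bsdp_of_pPartOverC_of_bsdp_twist` (`K ∧ Wd ⟹ W`) and EXACTNESS
`missingPPartOverCAt_iff_bsdp` (`W ∧ Wd ⟹ K`); same algebra ((★) + `ord_p`).  (GZK `hGZK`, modularity `hmod`.) [folklore] -/
theorem bsdp_twist_of_pPartOverC_of_bsdp
    (hGZK : rank_eq_analyticRank_of_analyticRank_le_one) (hmod : hasEntireLFunction_rat)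
    (hr : W.analyticRank ≤ 1) (h2 : Module.finrank ℚ K = 2)
    (hWd : ∃ C : VariableChange ℚ, C • W.quadraticTwist (NumberField.discr K : ℚ) = Wd)
    (hrd : Wd.analyticRank ≤ 1)
    (hV : ∃ C : VariableChange K, C • W.baseChange K = V) (hshaK : V.ShaFinite)
    (hWR : (V.shaOrder : ℝ) * V.regulator * V.bsdPeriod * (V.modifiedTamagawaProduct : ℝ) /
        (V.torsionOrder : ℝ) ^ 2 = W.bsdRHS * Wd.bsdRHS)
    (hK : MissingPPartOverCAt V p) (hW : BSDp W p) : BSDp Wd p := by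
  obtain ⟨-, hfinW⟩ := hGZK W hr
  obtain ⟨-, hfinD⟩ := hGZK Wd hrd
  haveI : Finite W.sha := hfinW
  obtain ⟨q, hq, hv⟩ := missingPPartAt_of_bsdp W p hW
  obtain ⟨q', hq', hv'⟩ := hK
  have hqd := exists_shaAn_twist_eq_of_overC W K Wd V hmod h2 hWd hV hfinW hfinD hshaK hWR hq' hq
  refine bsdp_of_missingPPartAt Wd p hGZK hrd ⟨_, hqd, ?_⟩
  -- valuations: `ord q' = ord #Ш(V)`, `ord q = ord #Ш(W)`
  have hsW : W.shaOrder ≠ 0 := (W.shaOrder_pos hfinW).ne'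
  have hsD : Wd.shaOrder ≠ 0 := (Wd.shaOrder_pos hfinD).ne'
  have hsK : V.shaOrder ≠ 0 := (V.shaOrder_pos hshaK).ne'
  have hq0 : q ≠ 0 := by
    intro h0; apply shaAn_ne_zero W hmod; rw [hq, h0, Rat.cast_zero]
  have hq'0 : q' ≠ 0 := by
    intro h0
    have hstar := shaAnOverC_mul_eq W K Wd V hmod h2 hWd hV hfinW hfinD hWR
    rw [hq', h0, Rat.cast_zero, zero_mul, zero_mul] at hstar
    have hqd0 : shaAn Wd ≠ 0 := shaAn_ne_zero Wd hmod
    exact mul_ne_zero (mul_ne_zero (shaAn_ne_zero W hmod) hqd0) (by exact_mod_cast hsK) hstar.symm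
  have hsWq : (W.shaOrder : ℚ) ≠ 0 := by exact_mod_cast hsW
  have hsDq : (Wd.shaOrder : ℚ) ≠ 0 := by exact_mod_cast hsD
  have hsKq : (V.shaOrder : ℚ) ≠ 0 := by exact_mod_cast hsK
  rw [padicValRat.div (mul_ne_zero (mul_ne_zero hq'0 hsWq) hsDq) (mul_ne_zero hq0 hsKq),
    padicValRat.mul (mul_ne_zero hq'0 hsWq) hsDq, padicValRat.mul hq'0 hsWq, padicValRat.mul hq0 hsKq,
    hv, hv', padicValRat.of_nat, padicValRat.of_nat, padicValRat.of_nat]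
  ring

/-- **The triangle, model-free**: given `MissingPPartOverCAt V p` (the `p`-part of BSD over `K`), **`BSDp W p ↔ BSDp Wd p`** for the
quadratic-twist pair `(W, Wd)` of analytic ranks `≤ 1`.  (`→` = the ascent above; `←` = the tree's descent.) [folklore] -/
theorem bsdp_iff_bsdp_twist_of_pPartOverC
    (hGZK : rank_eq_analyticRank_of_analyticRank_le_one) (hmod : hasEntireLFunction_rat)
    (hr : W.analyticRank ≤ 1) (h2 : Module.finrank ℚ K = 2)
    (hWd : ∃ C : VariableChange ℚ, C • W.quadraticTwist (NumberField.discr K : ℚ) = Wd)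
    (hrd : Wd.analyticRank ≤ 1)
    (hV : ∃ C : VariableChange K, C • W.baseChange K = V) (hshaK : V.ShaFinite)
    (hWR : (V.shaOrder : ℝ) * V.regulator * V.bsdPeriod * (V.modifiedTamagawaProduct : ℝ) /
        (V.torsionOrder : ℝ) ^ 2 = W.bsdRHS * Wd.bsdRHS)
    (hK : MissingPPartOverCAt V p) : BSDp W p ↔ BSDp Wd p :=
  ⟨bsdp_twist_of_pPartOverC_of_bsdp W p K Wd V hGZK hmod hr h2 hWd hrd hV hshaK hWR hK,
    bsdp_of_pPartOverC_of_bsdp_twist W p K Wd V hGZK hmod hr h2 hWd hrd hV hshaK hWR hK⟩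

end ModelFree

/-! ## §2 ASCENT on the canonical model `W.baseChange K`, Milne 1972 discharged -/

section BaseChange

variable (W : WeierstrassCurve ℚ) [W.IsElliptic] [W.IsGloballyMinimal] (p : ℕ) [Fact p.Prime]
  (K : Type) [Field K] [NumberField K]
  (Wd : WeierstrassCurve ℚ) [Wd.IsElliptic] [Wd.IsGloballyMinimal]

/-- **ASCENT on the canonical model, Milne discharged.**  For `W/ℚ` globally minimal of analytic rank `≤ 1` WITH `BSD(W,p)`, `K` quadratic and
`Wd` a globally minimal model of `W^{(d_K)}` of analytic rank `≤ 1`: **`MissingPPartOverCAt (W.baseChange K) p → BSDp Wd p`** — the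
model-free Weil-restriction identity and the finiteness of `Ш(E_K)` from `Milne1972.bsdQuotient_baseChange_quadratic_anyModel` (`hMilneC`),
finiteness over `ℚ` from GZK (`hGZK`).  Mirror of the tree's `bsdp_of_pPartOverC_baseChange`. [cite: Milne1972ArithmeticAV, §1 Thm. 1]
[cite: Miller2011LMS, Def. 1.1] -/
theorem bsdp_twist_of_pPartOverC_baseChange_of_bsdp
    (hGZK : rank_eq_analyticRank_of_analyticRank_le_one) (hmod : hasEntireLFunction_rat)
    (hMilneC : Milne1972.bsdQuotient_baseChange_quadratic_anyModel)
    (hr : W.analyticRank ≤ 1) (h2 : Module.finrank ℚ K = 2)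
    (hWd : ∃ C : VariableChange ℚ, C • W.quadraticTwist (NumberField.discr K : ℚ) = Wd)
    (hrd : Wd.analyticRank ≤ 1)
    (hK : MissingPPartOverCAt (W.baseChange K) p) (hW : BSDp W p) : BSDp Wd p := by
  haveI : (W.baseChange K).IsElliptic := by rw [baseChange]; infer_instance
  have hV : ∃ C : VariableChange K, C • W.baseChange K = W.baseChange K := ⟨1, one_smul _ _⟩
  obtain ⟨-, hfinW⟩ := hGZK W hr
  obtain ⟨-, hfinD⟩ := hGZK Wd hrd
  obtain ⟨hshaK, hWR⟩ := hMilneC W K h2 Wd hWd (W.baseChange K) hV hfinW hfinD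
  exact bsdp_twist_of_pPartOverC_of_bsdp W p K Wd (W.baseChange K) hGZK hmod hr h2 hWd hrd hV hshaK hWR hK hW

/-- **The triangle on the canonical model**: given `MissingPPartOverCAt (W.baseChange K) p`, **`BSDp W p ↔ BSDp Wd p`** (Milne any-model,
GZK, modularity; any `p`).  Together with the tree's `missingPPartOverCAt_baseChange_iff_bsdp` (given `BSD(Wd,p)`: `K ↔ W`): ANY TWO of
`BSD(W,p)`, `BSD(Wd,p)`, `MissingPPartOverCAt (W ⊗ K) p` give the third. [cite: Milne1972ArithmeticAV, §1 Thm. 1] [cite: Miller2011LMS, Def. 1.1] -/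
theorem bsdp_iff_bsdp_twist_of_pPartOverC_baseChange
    (hGZK : rank_eq_analyticRank_of_analyticRank_le_one) (hmod : hasEntireLFunction_rat)
    (hMilneC : Milne1972.bsdQuotient_baseChange_quadratic_anyModel)
    (hr : W.analyticRank ≤ 1) (h2 : Module.finrank ℚ K = 2)
    (hWd : ∃ C : VariableChange ℚ, C • W.quadraticTwist (NumberField.discr K : ℚ) = Wd)
    (hrd : Wd.analyticRank ≤ 1)
    (hK : MissingPPartOverCAt (W.baseChange K) p) : BSDp W p ↔ BSDp Wd p :=
  ⟨bsdp_twist_of_pPartOverC_baseChange_of_bsdp W p K Wd hGZK hmod hMilneC hr h2 hWd hrd hK,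
    bsdp_of_pPartOverC_baseChange W p K Wd hGZK hmod hMilneC hr h2 hWd hrd hK⟩

/-- **`MissingPPartOverCAt (W ⊗ K) p` from `BSD(W,p)` and `BSD(Wd,p)`, the twin's side** (the tree's `missingPPartOverCAt_baseChange_iff_bsdp`
takes `BSD(Wd,p)` as the standing hypothesis; recorded here with the roles displayed symmetrically, for the triangle's bookkeeping).
[cite: Milne1972ArithmeticAV, §1 Thm. 1] -/
theorem pPartOverC_baseChange_of_bsdp_of_bsdp_twist
    (hGZK : rank_eq_analyticRank_of_analyticRank_le_one) (hmod : hasEntireLFunction_rat)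
    (hMilneC : Milne1972.bsdQuotient_baseChange_quadratic_anyModel)
    (hr : W.analyticRank ≤ 1) (h2 : Module.finrank ℚ K = 2)
    (hWd : ∃ C : VariableChange ℚ, C • W.quadraticTwist (NumberField.discr K : ℚ) = Wd)
    (hrd : Wd.analyticRank ≤ 1) (hW : BSDp W p) (hd : BSDp Wd p) : MissingPPartOverCAt (W.baseChange K) p :=
  (missingPPartOverCAt_baseChange_iff_bsdp W p K Wd hGZK hmod hMilneC hr h2 hWd hrd hd).mpr hW

end BaseChange

end Summit.BirchSwinnertonDyer.BirchSwinnertonDyer.Theorems.GenusExact.TwinSwap.Ascent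

end
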